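import Literature.Analysis.FluidPDE.ElgindiSlabFamilies
import Literature.Analysis.Calculus.SeeleyExtension
import Literature.Analysis.Distribution.DivFormRegularity
import Mathlib.Analysis.SpecialFunctions.SmoothTransition
import Mathlib.Analysis.SpecialFunctions.Log.Deriv
import HarnessLib

/-!
# A global smooth profile: `ηΨ = cos θ·χ̃` on the strip with `χ̃ ∈ C_c^∞`, `χ̃(R,0) = 0`
([Elgindi2021] §7.1 Proposition 7.1: the `L²` solution lies in the class `Ψ = cos θ·χ`)

Topic `Literature/Analysis/FluidPDE`. Support file (definitions with bodies and proved theorems, no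
named facts) on the proof path of the named fact
`Literature.Analysis.FluidPDE.Elgindi.ElgindiGhoulMasmoudi2021_stabilityCore`
(`ElgindiStabilityDecomposition.lean`). T. M. Elgindi, Ann. of Math. 194 (2021) =
arXiv:1904.04795, §7.1 Proposition 7.1 (p. 19 of the held text); R. T. Seeley, Proc. AMS 15
(1964) 625–626 (extension across a hyperplane; the tree's `Seeley.contDiffOn_extend`).

For a `TangentialFamily α f Ψ` the within-smooth functions `(θ,s) ↦ Ψ̃(eˢ,θ)` on `[0,π/4) × ℝ` and
`(σ,s) ↦ χ(eˢ, π/2 − σ)` on `[0,π/2) × ℝ` (`ElgindiSlabFamilies.lean`) are extended across the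
boundary lines by Seeley's operator, divided by `cos θ` near `θ = 0`, glued by a partition of
unity in `θ`, and cut off radially: for every `η ∈ C_c^∞((0,∞))` there is `χ̃ ∈ C_c^∞(ℝ²)`
supported in `R > 0` with `χ̃(R,0) = 0` and `cos θ·χ̃ = η(R)Ψ` on the strip
(`exists_smooth_profile`) — i.e. `ηΨ` belongs to the a-priori class of Elgindi's estimates.
-/

noncomputable section

open MeasureTheory Set Real Filter Function
open _root_.Topology
open scoped ContDiff

namespace Literature.Analysis.FluidPDE

namespace Elgindi

/-! ### Smooth steps and the angular partition of unity -/

/-- The smooth step: `0` for `θ ≤ a`, `1` for `θ ≥ b` (`a < b`). [folklore] -/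
def smoothStepAB (a b θ : ℝ) : ℝ := Real.smoothTransition ((θ - a) / (b - a))

/-- The smooth step is smooth. [folklore] -/
theorem contDiff_smoothStepAB (a b : ℝ) {n : ℕ∞} : ContDiff ℝ n (smoothStepAB a b) := by
  unfold smoothStepAB
  exact Real.smoothTransition.contDiff.comp ((contDiff_id.sub contDiff_const).div_const _)

/-- `= 0` below `a`. [folklore] -/
theorem smoothStepAB_of_le {a b θ : ℝ} (hab : a < b) (h : θ ≤ a) : smoothStepAB a b θ = 0 :=
  Real.smoothTransition.zero_of_nonpos (div_nonpos_of_nonpos_of_nonneg (by linarith) (by linarith))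

/-- `= 1` above `b`. [folklore] -/
theorem smoothStepAB_of_ge {a b θ : ℝ} (hab : a < b) (h : b ≤ θ) : smoothStepAB a b θ = 1 :=
  Real.smoothTransition.one_of_one_le (by rw [le_div_iff₀ (by linarith)]; linarith)

/-- The weight near `θ = π/2`: `ρ₁ = 0` for `θ ≤ π/8`, `= 1` for `θ ≥ 3π/16`. [folklore] -/
def rho1 (θ : ℝ) : ℝ := smoothStepAB (π / 8) (3 * π / 16) θ

/-- The lower cutoff: `κ = 0` for `θ ≤ −π/4`, `= 1` for `θ ≥ −π/8`. [folklore] -/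
def kappaLow (θ : ℝ) : ℝ := smoothStepAB (-(π / 4)) (-(π / 8)) θ

/-- The weight near `θ = 0`: `ρ₀ = (1 − ρ₁)κ`, supported in `(−π/4, 3π/16)`. [folklore] -/
def rho0 (θ : ℝ) : ℝ := (1 - rho1 θ) * kappaLow θ

/-- The global angular cutoff: `= 1` on `[−π/8, π/2 + π/16]`, supported in `[−π/4, π/2 + π/8]`. [folklore] -/
def kappaAng (θ : ℝ) : ℝ := (1 - smoothStepAB (π / 2 + π / 16) (π / 2 + π / 8) θ) * kappaLow θ

/-- `π/8 < 3π/16`. [folklore] -/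
theorem h18 : π / 8 < 3 * π / 16 := by linarith [Real.pi_pos]
/-- `−π/4 < −π/8`. [folklore] -/
theorem h48 : -(π / 4) < -(π / 8) := by linarith [Real.pi_pos]
/-- `π/2 + π/16 < π/2 + π/8`. [folklore] -/
theorem h216 : π / 2 + π / 16 < π / 2 + π / 8 := by linarith [Real.pi_pos]

/-- Smoothness of the weights. [folklore] -/
theorem contDiff_rho1 {n : ℕ∞} : ContDiff ℝ n rho1 := contDiff_smoothStepAB _ _
/-- Smoothness of the weights. [folklore] -/
theorem contDiff_kappaLow {n : ℕ∞} : ContDiff ℝ n kappaLow := contDiff_smoothStepAB _ _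
/-- Smoothness of the weights. [folklore] -/
theorem contDiff_rho0 {n : ℕ∞} : ContDiff ℝ n rho0 := (contDiff_const.sub contDiff_rho1).mul contDiff_kappaLow
/-- Smoothness of the weights. [folklore] -/
theorem contDiff_kappaAng {n : ℕ∞} : ContDiff ℝ n kappaAng := (contDiff_const.sub (contDiff_smoothStepAB _ _)).mul contDiff_kappaLow

/-- `ρ₀ + ρ₁ = 1` on `[0, π/2]` (indeed on `θ ≥ −π/8`). [folklore] -/
theorem rho0_add_rho1 {θ : ℝ} (hθ : -(π / 8) ≤ θ) : rho0 θ + rho1 θ = 1 := by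
  unfold rho0 kappaLow; rw [smoothStepAB_of_ge h48 hθ]; ring

/-- `ρ₀ = 0` for `θ ≥ 3π/16` and for `θ ≤ −π/4`. [folklore] -/
theorem rho0_eq_zero {θ : ℝ} (hθ : 3 * π / 16 ≤ θ ∨ θ ≤ -(π / 4)) : rho0 θ = 0 := by
  unfold rho0 rho1 kappaLow
  rcases hθ with h | h
  · rw [smoothStepAB_of_ge h18 h]; ring
  · rw [smoothStepAB_of_le h48 h]; ring

/-- `ρ₁ = 0` for `θ ≤ π/8`. [folklore] -/
theorem rho1_eq_zero {θ : ℝ} (hθ : θ ≤ π / 8) : rho1 θ = 0 := smoothStepAB_of_le h18 hθ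

/-- `κ_ang = 1` on `[−π/8, π/2 + π/16]`. [folklore] -/
theorem kappaAng_eq_one {θ : ℝ} (h1 : -(π / 8) ≤ θ) (h2 : θ ≤ π / 2 + π / 16) : kappaAng θ = 1 := by
  unfold kappaAng kappaLow; rw [smoothStepAB_of_ge h48 h1, smoothStepAB_of_le h216 h2]; ring

/-- `κ_ang = 0` off `[−π/4, π/2 + π/8]`. [folklore] -/
theorem kappaAng_eq_zero {θ : ℝ} (hθ : π / 2 + π / 8 ≤ θ ∨ θ ≤ -(π / 4)) : kappaAng θ = 0 := by
  unfold kappaAng kappaLow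
  rcases hθ with h | h
  · rw [smoothStepAB_of_ge h216 h]; ring
  · rw [smoothStepAB_of_le h48 h]; ring

/-- `κ_ang` has compact support. [folklore] -/
theorem hasCompactSupport_kappaAng : HasCompactSupport kappaAng := by
  refine HasCompactSupport.of_support_subset_isCompact (isCompact_Icc (a := -(π / 4)) (b := π / 2 + π / 8)) fun θ hθ => ?_
  by_contra hc
  simp only [mem_Icc, not_and_or, not_le] at hc
  apply hθ
  rcases hc with h | h
  · exact kappaAng_eq_zero (Or.inr h.le)
  · exact kappaAng_eq_zero (Or.inl h.le)

/-! ### Products with functions smooth near the support -/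

/-- A smooth factor of `θ` times a function smooth on an open set containing the product of
`(0,∞)` with the support of the factor is smooth on `(0,∞) × ℝ`. [folklore] -/
theorem contDiffOn_mul_of_theta_support {μ : ℝ → ℝ} (hμ : ContDiff ℝ ∞ μ) {g : ℝ × ℝ → ℝ} {U : Set (ℝ × ℝ)} (hU : IsOpen U)
    (hg : ContDiffOn ℝ ∞ g U) (hsupp : ∀ p : ℝ × ℝ, 0 < p.1 → p.2 ∈ tsupport μ → p ∈ U) :
    ContDiffOn ℝ ∞ (fun p : ℝ × ℝ => μ p.2 * g p) (Ioi 0 ×ˢ univ) := by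
  intro p hp
  by_cases hθ : p.2 ∈ tsupport μ
  · have hpU : p ∈ U := hsupp p hp.1 hθ
    exact ((hμ.comp contDiff_snd).contDiffAt.mul (hg.contDiffAt (hU.mem_nhds hpU))).contDiffWithinAt
  · have hev : (fun p : ℝ × ℝ => μ p.2) =ᶠ[𝓝 p] 0 := by
      have h0 : μ =ᶠ[𝓝 p.2] 0 := notMem_tsupport_iff_eventuallyEq.1 hθ
      exact continuousAt_snd.eventually h0 |>.mono fun q hq => by simpa using hq
    have hev' : (fun p : ℝ × ℝ => μ p.2 * g p) =ᶠ[𝓝 p] fun _ => 0 := by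
      filter_upwards [hev] with q hq; rw [hq]; simp
    exact ((contDiffAt_const (c := (0:ℝ))).congr_of_eventuallyEq hev').contDiffWithinAt

namespace TangentialFamily

variable {α : ℝ} {f Ψ : ℝ → ℝ → ℝ} (h : TangentialFamily α f Ψ)
include h

/-! ### The two local profiles -/

/-- The profile near `θ = 0`: `χ₀(R,θ) = (E₀Ψ̂)(θ, log R)/cos θ`, `E₀` Seeley's extension of
`(θ,s) ↦ Ψ̃(eˢ,θ)` across `θ = 0`. [folklore] -/
def chi0 (Ψ : ℝ → ℝ → ℝ) (p : ℝ × ℝ) : ℝ :=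
  Literature.Analysis.Calculus.Seeley.extend (π / 4) (fun q : ℝ × ℝ => bext Ψ (Real.exp q.2, q.1)) (p.2, Real.log p.1) / Real.cos p.2

/-- The profile near `θ = π/2`: `χ₁(R,θ) = (E₁ẑ₀)(π/2 − θ, log R)`. [folklore] -/
def chi1 (Ψ : ℝ → ℝ → ℝ) (p : ℝ × ℝ) : ℝ :=
  Literature.Analysis.Calculus.Seeley.extend (π / 2) (fun q : ℝ × ℝ => bext (zRefl Ψ 0) (Real.exp q.2, q.1)) (π / 2 - p.2, Real.log p.1)

/-- `χ₀ ∈ C^∞((0,∞) × (−π/2, π/4))`. [folklore] -/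
theorem contDiffOn_chi0 : ContDiffOn ℝ ∞ (chi0 Ψ) (Ioi 0 ×ˢ Ioo (-(π / 2)) (π / 4)) := by
  have hE := Literature.Analysis.Calculus.Seeley.contDiffOn_extend (E' := ℝ) (F := ℝ) (δ := π / 4) (B := univ)
    (by positivity) isOpen_univ (f := fun q : ℝ × ℝ => bext Ψ (Real.exp q.2, q.1)) h.contDiffOn_slab_zero
  have hmap : ContDiffOn ℝ ∞ (fun p : ℝ × ℝ => ((p.2, Real.log p.1) : ℝ × ℝ)) (Ioi 0 ×ˢ Ioo (-(π / 2)) (π / 4)) :=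
    contDiffOn_snd.prodMk (Real.contDiffOn_log.comp contDiffOn_fst fun p hp => ne_of_gt hp.1)
  have hcomp := hE.comp hmap fun p hp => ⟨hp.2.2, mem_univ _⟩
  unfold chi0
  exact hcomp.div (Real.contDiff_cos.comp_contDiffOn contDiffOn_snd) fun p hp => (Real.cos_pos_of_mem_Ioo ⟨hp.2.1, by linarith [hp.2.2, Real.pi_pos]⟩).ne'

/-- `χ₁ ∈ C^∞((0,∞) × (0,∞))`. [folklore] -/
theorem contDiffOn_chi1 : ContDiffOn ℝ ∞ (chi1 Ψ) (Ioi 0 ×ˢ Ioi 0) := by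
  have hE := Literature.Analysis.Calculus.Seeley.contDiffOn_extend (E' := ℝ) (F := ℝ) (δ := π / 2) (B := univ)
    (by positivity) isOpen_univ (f := fun q : ℝ × ℝ => bext (zRefl Ψ 0) (Real.exp q.2, q.1)) h.contDiffOn_slab_halfPi
  have hmap : ContDiffOn ℝ ∞ (fun p : ℝ × ℝ => ((π / 2 - p.2, Real.log p.1) : ℝ × ℝ)) (Ioi 0 ×ˢ Ioi 0) :=
    (contDiffOn_const.sub contDiffOn_snd).prodMk (Real.contDiffOn_log.comp contDiffOn_fst fun p hp => ne_of_gt hp.1)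
  unfold chi1
  exact hE.comp hmap fun p hp => ⟨by show π / 2 - p.2 < π / 2; have : (0:ℝ) < p.2 := hp.2; linarith, mem_univ _⟩

/-- On the strip `χ₀ = Ψ/cos θ`. [folklore] -/
theorem chi0_eq {p : ℝ × ℝ} (hp : p ∈ strip) : chi0 Ψ p = Ψ p.1 p.2 / Real.cos p.2 := by
  have := h
  unfold chi0
  rw [Literature.Analysis.Calculus.Seeley.extend_of_nonneg (by exact hp.2.1.le)]
  simp only
  rw [Real.exp_log hp.1, bext_of_pos Ψ (p := (p.1, p.2)) hp.2.1]

/-- On the strip `χ₁ = Ψ/cos θ`. [folklore] -/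
theorem chi1_eq {p : ℝ × ℝ} (hp : p ∈ strip) : chi1 Ψ p = Ψ p.1 p.2 / Real.cos p.2 := by
  have := h
  unfold chi1
  have hσ : 0 < π / 2 - p.2 := by linarith [hp.2.2]
  rw [Literature.Analysis.Calculus.Seeley.extend_of_nonneg (by exact hσ.le)]
  simp only
  rw [Real.exp_log hp.1, bext_of_pos (zRefl Ψ 0) (p := (p.1, π / 2 - p.2)) hσ]
  show (Dz^[0] Ψ) p.1 (π / 2 - (π / 2 - p.2)) / Real.sin (π / 2 - p.2) = _
  rw [Real.sin_pi_div_two_sub]; simp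

/-- `χ₀(R, 0) = 0` for `R > 0` (the Dirichlet condition). [folklore] -/
theorem chi0_zero {R : ℝ} (hR : 0 < R) : chi0 Ψ (R, 0) = 0 := by
  unfold chi0
  rw [Literature.Analysis.Calculus.Seeley.extend_of_nonneg (by exact le_rfl)]
  simp only [Real.cos_zero, div_one]
  rw [Real.exp_log hR]
  -- `bext Ψ (R, 0) = lim_{θ→0⁺} Ψ(R,θ) = 0`
  have hlim := (h.slice 0 hR).2.2.1
  have hext : ExtZero (π / 4) (Dz^[0] Ψ) := h.extZero_iterate 0
  have := hext.limUnder_eq (by positivity) hR hlim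
  simpa using this

/-! ### The glued global profile -/

/-- **The glued, cut-off profile** `χ̃_η(R,θ) = η(R)κ(θ)(ρ₀(θ)χ₀ + ρ₁(θ)χ₁)(R,θ)`. [folklore] -/
def profile (Ψ : ℝ → ℝ → ℝ) (η : ℝ → ℝ) : ℝ → ℝ → ℝ := fun R θ =>
  η R * (kappaAng θ * (rho0 θ * chi0 Ψ (R, θ) + rho1 θ * chi1 Ψ (R, θ)))

/-- The glued profile is smooth on `(0,∞) × ℝ`. [folklore] -/
theorem contDiffOn_glued : ContDiffOn ℝ ∞ (fun p : ℝ × ℝ => kappaAng p.2 * (rho0 p.2 * chi0 Ψ p + rho1 p.2 * chi1 Ψ p)) (Ioi 0 ×ˢ univ) := by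
  have h0 : ContDiffOn ℝ ∞ (fun p : ℝ × ℝ => rho0 p.2 * chi0 Ψ p) (Ioi 0 ×ˢ univ) := by
    refine contDiffOn_mul_of_theta_support contDiff_rho0 (isOpen_Ioi.prod isOpen_Ioo) h.contDiffOn_chi0 fun p hp1 hp2 => ⟨hp1, ?_⟩
    -- `tsupport ρ₀ ⊆ [−π/4, 3π/16] ⊆ (−π/2, π/4)`
    by_contra hc
    simp only [mem_Ioo, not_and_or, not_lt] at hc
    have hzero : rho0 =ᶠ[𝓝 p.2] 0 := by
      rcases hc with hc | hc
      · filter_upwards [Iio_mem_nhds (show p.2 < -(π / 4) by linarith [Real.pi_pos])] with θ hθ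
        exact rho0_eq_zero (Or.inr (le_of_lt hθ))
      · filter_upwards [Ioi_mem_nhds (show 3 * π / 16 < p.2 by linarith [Real.pi_pos])] with θ hθ
        exact rho0_eq_zero (Or.inl (le_of_lt hθ))
    exact (notMem_tsupport_iff_eventuallyEq.2 hzero) hp2
  have h1 : ContDiffOn ℝ ∞ (fun p : ℝ × ℝ => rho1 p.2 * chi1 Ψ p) (Ioi 0 ×ˢ univ) := by
    refine contDiffOn_mul_of_theta_support contDiff_rho1 (isOpen_Ioi.prod isOpen_Ioi) h.contDiffOn_chi1 fun p hp1 hp2 => ⟨hp1, ?_⟩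
    by_contra hc
    simp only [mem_Ioi, not_lt] at hc
    have hzero : rho1 =ᶠ[𝓝 p.2] 0 := by
      filter_upwards [Iio_mem_nhds (show p.2 < π / 8 by linarith [Real.pi_pos])] with θ hθ
      exact rho1_eq_zero hθ.le
    exact (notMem_tsupport_iff_eventuallyEq.2 hzero) hp2
  exact ((contDiff_kappaAng.comp contDiff_snd).contDiffOn).mul (h0.add h1)

/-- **The cut-off profile is globally smooth** for `η ∈ C^∞` supported in `R > 0`. [folklore] -/
theorem contDiff_profile {η : ℝ → ℝ} (hη : ContDiff ℝ ∞ η) (hηpos : tsupport η ⊆ Ioi 0) :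
    ContDiff ℝ ∞ (uncurry (profile Ψ η)) := by
  have e : uncurry (profile Ψ η) = fun p : ℝ × ℝ => (η ∘ Prod.fst) p * (kappaAng p.2 * (rho0 p.2 * chi0 Ψ p + rho1 p.2 * chi1 Ψ p)) := by
    funext p; rfl
  rw [e]
  refine Literature.Analysis.Distribution.contDiff_mul_of_tsupport_subset (isOpen_Ioi.prod isOpen_univ) (hη.comp contDiff_fst) ?_ h.contDiffOn_glued
  intro p hp
  have hp' : p ∈ closure (Prod.fst ⁻¹' Function.support η) := by
    simpa [tsupport, Function.support_comp_eq_preimage] using hp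
  exact ⟨hηpos (continuous_fst.closure_preimage_subset _ hp'), mem_univ _⟩

/-- **On the strip `cos θ·χ̃_η = ηΨ`.** [folklore] -/
theorem cos_mul_profile_eq (η : ℝ → ℝ) {p : ℝ × ℝ} (hp : p ∈ strip) :
    Real.cos p.2 * profile Ψ η p.1 p.2 = η p.1 * Ψ p.1 p.2 := by
  have hcos : Real.cos p.2 ≠ 0 := (Real.cos_pos_of_mem_Ioo ⟨by linarith [hp.2.1, Real.pi_pos], hp.2.2⟩).ne'
  have hθ1 : -(π / 8) ≤ p.2 := by linarith [hp.2.1, Real.pi_pos]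
  have hθ2 : p.2 ≤ π / 2 + π / 16 := by linarith [hp.2.2, Real.pi_pos]
  unfold profile
  rw [kappaAng_eq_one hθ1 hθ2, h.chi0_eq (p := (p.1, p.2)) hp, h.chi1_eq (p := (p.1, p.2)) hp]
  simp only
  have hsum := rho0_add_rho1 hθ1
  field_simp
  linear_combination (η p.1 * Ψ p.1 p.2) * hsum

/-- **`χ̃_η(R, 0) = 0`** (for `η` supported in `R > 0`). [folklore] -/
theorem profile_zero {η : ℝ → ℝ} (hηpos : tsupport η ⊆ Ioi 0) (R : ℝ) : profile Ψ η R 0 = 0 := by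
  rcases le_or_gt R 0 with hR | hR
  · have hη : η R = 0 := image_eq_zero_of_notMem_tsupport fun hm => absurd (hηpos hm) (not_lt.2 hR)
    unfold profile; rw [hη, zero_mul]
  · unfold profile
    rw [rho1_eq_zero (by positivity), h.chi0_zero hR]; ring

omit h in
/-- The cut-off profile has compact support inside `R > 0`. [folklore] -/
theorem hasCompactSupport_profile {η : ℝ → ℝ} (hηs : HasCompactSupport η) :
    HasCompactSupport (uncurry (profile Ψ η)) := by
  have e : uncurry (profile Ψ η) = fun p : ℝ × ℝ => (η p.1 * kappaAng p.2) * (rho0 p.2 * chi0 Ψ p + rho1 p.2 * chi1 Ψ p) := by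
    funext p; simp only [uncurry, profile]; ring
  rw [e]
  refine HasCompactSupport.mul_right ?_
  exact HasCompactSupport.of_support_subset_isCompact (hηs.isCompact.prod hasCompactSupport_kappaAng.isCompact) fun p hp => by
    simp only [mem_support, ne_eq, mul_eq_zero, not_or] at hp
    exact ⟨subset_closure hp.1, subset_closure hp.2⟩

omit h in
/-- The support of the cut-off profile lies in `R > 0`. [folklore] -/
theorem tsupport_profile {η : ℝ → ℝ} (hηpos : tsupport η ⊆ Ioi 0) :
    ∀ p ∈ tsupport (uncurry (profile Ψ η)), 0 < p.1 := by
  intro p hp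
  have e : uncurry (profile Ψ η) = fun p : ℝ × ℝ => (η ∘ Prod.fst) p * (kappaAng p.2 * (rho0 p.2 * chi0 Ψ p + rho1 p.2 * chi1 Ψ p)) := by
    funext p; rfl
  rw [e] at hp
  have hp1 := tsupport_mul_subset_left hp
  have hp' : p ∈ closure (Prod.fst ⁻¹' Function.support η) := by
    simpa [tsupport, Function.support_comp_eq_preimage] using hp1
  exact hηpos (continuous_fst.closure_preimage_subset _ hp')

/-- **A global smooth profile**: for `η ∈ C_c^∞((0,∞))` there is `χ̃ ∈ C_c^∞(ℝ²)` supported in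
`R > 0`, vanishing on `θ = 0`, with `cos θ·χ̃ = η(R)·Ψ` on the strip. [cite: Elgindi2021, §7.1 Proposition 7.1 (p. 19 of arXiv:1904.04795); Seeley1964, Theorem] -/
theorem exists_smooth_profile {η : ℝ → ℝ} (hη : ContDiff ℝ ∞ η) (hηs : HasCompactSupport η) (hηpos : tsupport η ⊆ Ioi 0) :
    ∃ χt : ℝ → ℝ → ℝ, ContDiff ℝ ∞ (uncurry χt) ∧ HasCompactSupport (uncurry χt) ∧
      (∀ p ∈ tsupport (uncurry χt), 0 < p.1) ∧ (∀ R, χt R 0 = 0) ∧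
      ∀ p ∈ strip, Real.cos p.2 * χt p.1 p.2 = η p.1 * Ψ p.1 p.2 :=
  ⟨profile Ψ η, h.contDiff_profile hη hηpos, hasCompactSupport_profile hηs, tsupport_profile hηpos,
    h.profile_zero hηpos, fun _ hp => h.cos_mul_profile_eq η hp⟩

end TangentialFamily

end Elgindi

end Literature.Analysis.FluidPDE
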